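import Literature.AlgebraicGeometry.Frobenioids.Prop55Sub
import Literature.AlgebraicGeometry.Frobenioids.ModelFrobenioidUntr
import Literature.AlgebraicGeometry.Frobenioids.ModelFrobenioidPreFrobenioid
import Literature.AlgebraicGeometry.Frobenioids.PadicFrobenioidIsFrobenioid
import HarnessLib

/-!
# Frobenioids I, Thm. 5.2 (ii) / Prop. 5.5 (iv): for a model Frobenioid, `Φ^birat` IS the image of `Div_B`;
# hence `C^rlf` is the model Frobenioid of `(Φ^rlf, ℝ · Div_B(B))` — the slot `Prop55iv_rlf` PROVED

Mochizuki, *The geometry of Frobenioids I*, Kyushu J. Math. **62** (2008): Thm. 5.2, kurims p. 100 ("the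
group-like monoid `Φ^birat ⊆ Φ^gp` determined by the image of `Div_B`"), Thm. 5.2 (ii) p. 101 ("the rational
function monoid of `C` is `Φ^birat`"), Prop. 5.5 (iv) p. 104 ll. 40–44 ("If `C` is the model Frobenioid
associated to data `Φ, B, Div_B` … and `Φ^birat ⊆ Φ^gp` is the image of `Div_B`, then there is a natural
equivalence of categories between … `C^rlf` … and the model Frobenioid associated to the data
`Φ^rlf, ℝ · Φ^birat, ℝ · Φ^birat ↪ (Φ^rlf)^gp`"), proof p. 105 l. 26 ("follows immediately from the
definitions") [cite: MochizukiFrdI2008, Thm. 5.2 (ii) p.101] [cite: MochizukiFrdI2008, Prop. 5.5 (iv) p.104].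

PROOF-ONLY (no definitions).  For the model Frobenioid `C` of `(Φ, B, Div_B)` with `B` group-like and the
tree's CONCRETE rational-function subfunctor `Φ^birat` (`PreFrobenioid.biratSubfunctor`, seat abc-iut-L1-t5:
generated by the germs `Φ(δ₁)⁻¹Div(δ₁) − Φ(δ₂)⁻¹Div(δ₂)` of base-equivalent pre-steps):
* `biratGerms_subset_biratSubmonoid` — every germ is a value of `Div_B` (subtract the relations (d) of
  Thm. 5.2 (i) of the two pre-steps);
* `divB_mem_biratSubfunctor` — every `Div_B(b)` is a germ (the pre-steps `(1, id, x, b)`, `(1, id, y, 1)` out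
  of `(A_D, −y)` where `Div_B(b) = x − y`);
* **`biratSubfunctor_eq_ofModelData`**: `Φ^birat(C) =` the image of `Div_B` (abc-iut-w4-d084's
  `GpSubfunctor.ofModelData`), and `isImageOfDivB_biratSubfunctor` (abc-iut-L1-t2's interface `IsImageOfDivB`);
* **`prop55iv_rlf_holds : FrdI.Prop55Sub.Prop55iv_rlf Φ B DivB hB hΦ`** — THE realification
  `C^rlf = rlf (toElem Φ B DivB) hΦ` (seat abc-iut-L1-d2, the model Frobenioid of `(Φ^rlf, ℝ · Φ^birat)`) is then
  LITERALLY the model Frobenioid of `(Φ^rlf, ℝ · Div_B(B))`, the equivalence being the identity and the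
  compatibility with the functors to `F_{Φ^rlf}` the unitor.
Seat abc-iut-L1-d2 (cell abc-iut); sub-DAG row FrdI:Prop5.5(iv)/P55-L08 (`C^rlf` row; slot map abc-iut-w4-d084
STATUS 23:43:22Z; L1-lead R79 — the assignee released its seat, d2g2 takes the `rlf` slot it was named for in
the sub-DAG).
-/

noncomputable section

namespace Literature.AlgebraicGeometry.Frobenioids

open CategoryTheory Opposite Literature.AnabelianGeometry.EtaleTheta

universe w v u

/-- A subfunctor of groups is determined by its values. [cite: MochizukiFrdI2008, Prop. 4.4 (iii) p.83] -/
theorem GpSubfunctor.ext_carrier {D : Type u} [Category.{v} D] {Φ : Dᵒᵖ ⥤ CommMonCat.{w}}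
    {Ψ₁ Ψ₂ : GpSubfunctor Φ} (h : Ψ₁.carrier = Ψ₂.carrier) : Ψ₁ = Ψ₂ := by
  cases Ψ₁; cases Ψ₂; cases h; rfl

namespace ModelFrobenioid

variable {D : Type u} [Category.{v} D] {Φ B : Dᵒᵖ ⥤ CommMonCat.{w}} {DivB : B ⟶ monoidGp Φ}

/-- `B` with every element a unit is (objectwise) group-like. [cite: MochizukiFrdI2008, Thm. 5.2 p.100] -/
theorem isGroupLike_of_isUnit (hB : ∀ (A : Dᵒᵖ) (b : B.obj A), IsUnit b) :
    Objectwise (fun M _ => IsGroupLike M) B :=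
  fun X => isGroupLike_of_forall_isUnit (hB (op X))

/-! ### Germs of the model Frobenioid are values of `Div_B` -/

/-- **Every birational germ of the model Frobenioid is a value of `Div_B`**: for base-equivalent pre-steps
`δ₁, δ₂ : Y → A` the relations (d) `β + Div(δ_i) = f^*α + Div_B(u_i)` give
`Φ(f)⁻¹(Div δ₁ − Div δ₂) = Div_B(B(f⁻¹)(u₁ − u₂))`. [cite: MochizukiFrdI2008, Thm. 5.2 (ii) p.101] -/
theorem biratGerms_subset_biratSubmonoid (hB : ∀ (A : Dᵒᵖ) (b : B.obj A), IsUnit b)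
    (A : ModelFrobenioid Φ B DivB) :
    PreFrobenioid.biratGerms (toElem Φ B DivB) A ⊆
      (biratSubmonoid Φ B DivB (op A.base) : Set (Algebra.GrothendieckGroup (Φ.obj (op A.base)))) := by
  rintro _ ⟨Y, δ₁, δ₂, h₁, h₂, hb, rfl⟩
  have hd₁ : degFr δ₁ = 1 := h₁.2.1
  have hd₂ : degFr δ₂ = 1 := h₂.1
  have hbase : baseMap δ₁ = baseMap δ₂ := hb
  haveI : IsIso (baseMap δ₁) := h₁.2.2
  haveI : IsIso (baseMap δ₂) := h₂.2
  -- the relations (d) in degree one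
  have r₁ := rel δ₁
  have r₂ := rel δ₂
  rw [hd₁, PNat.one_coe, pow_one] at r₁
  rw [hd₂, PNat.one_coe, pow_one, ← hbase] at r₂
  have e₁ : Algebra.GrothendieckGroup.of (div δ₁) =
      Y.cls⁻¹ * (pullGp Φ (baseMap δ₁) A.cls * divB Φ B DivB _ (unit δ₁)) := eq_inv_mul_of_mul_eq r₁
  have e₂ : Algebra.GrothendieckGroup.of (div δ₂) =
      Y.cls⁻¹ * (pullGp Φ (baseMap δ₁) A.cls * divB Φ B DivB _ (unit δ₂)) := eq_inv_mul_of_mul_eq r₂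
  -- `u₂` is a unit: `Div_B(v) = Div_B(u₂)⁻¹`
  obtain ⟨v, hv⟩ := (hB _ (unit δ₂)).exists_right_inv
  have hv' : divB Φ B DivB _ v = (divB Φ B DivB _ (unit δ₂))⁻¹ :=
    eq_inv_of_mul_eq_one_right (by rw [← map_mul, hv, map_one])
  have key : Algebra.GrothendieckGroup.of (div δ₁) / Algebra.GrothendieckGroup.of (div δ₂) =
      divB Φ B DivB (op Y.base) (unit δ₁ * v) := by
    rw [e₁, e₂, mul_div_mul_left_eq_div, mul_div_mul_left_eq_div, map_mul, hv', div_eq_mul_inv]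
  -- the germ, pulled back along `Base(δ)⁻¹`
  have hinv : inv (baseMap δ₂) = inv (baseMap δ₁) := IsIso.inv_eq_inv.mpr hbase.symm
  refine ⟨(B.map (inv (baseMap δ₁)).op).hom (unit δ₁ * v), ?_⟩
  show divB Φ B DivB _ _ = Algebra.GrothendieckGroup.of (Frobenioids.pull Φ (inv (baseMap δ₁)) (div δ₁)) /
    Algebra.GrothendieckGroup.of (Frobenioids.pull Φ (inv (baseMap δ₂)) (div δ₂))
  rw [hinv, ← pullGp_divB, ← key, map_div, pullGp_of, pullGp_of]
  rfl

/-! ### Every value of `Div_B` is a germ -/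

/-- **Every `Div_B(b)`, `b ∈ B(X)`, lies in `Φ^birat(X)` of the model Frobenioid**: writing `Div_B(b) = x − y`
with `x, y ∈ Φ(X)`, the arrows `(1, id_X, x, b)` and `(1, id_X, y, 0)` from `(X, −y)` to `(X, 0)` are
base-equivalent pre-steps (co-angular, as every arrow of a model Frobenioid) whose germ is `Div_B(b)`.
[cite: MochizukiFrdI2008, Thm. 5.2 (ii) p.101] -/
theorem divB_mem_biratSubfunctor (hB : ∀ (A : Dᵒᵖ) (b : B.obj A), IsUnit b) (X : D) (b : B.obj (op X)) :
    divB Φ B DivB (op X) b ∈ (PreFrobenioid.biratSubfunctor (toElem Φ B DivB)).carrier X := by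
  obtain ⟨⟨x, y⟩, hxy⟩ := (Localization.monoidOf (⊤ : Submonoid (Φ.obj (op X)))).surj (divB Φ B DivB (op X) b)
  have hbxy : divB Φ B DivB (op X) b =
      Algebra.GrothendieckGroup.of x / Algebra.GrothendieckGroup.of (y : Φ.obj (op X)) :=
    eq_div_iff_mul_eq'.mpr hxy
  let A : ModelFrobenioid Φ B DivB := ⟨X, 1⟩
  let Y : ModelFrobenioid Φ B DivB := ⟨X, (Algebra.GrothendieckGroup.of (y : Φ.obj (op X)))⁻¹⟩
  let δ₁ : Y ⟶ A :=
    { degFr := 1, base := 𝟙 X, div := x, unit := b,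
      rel := by
        show (Algebra.GrothendieckGroup.of (y : Φ.obj (op X)))⁻¹ ^ ((1 : ℕ+) : ℕ) *
            Algebra.GrothendieckGroup.of x = pullGp Φ (𝟙 X) 1 * divB Φ B DivB (op X) b
        rw [PNat.one_coe, pow_one, map_one, one_mul, hbxy, div_eq_mul_inv, mul_comm] }
  let δ₂ : Y ⟶ A :=
    { degFr := 1, base := 𝟙 X, div := (y : Φ.obj (op X)), unit := 1,
      rel := by
        show (Algebra.GrothendieckGroup.of (y : Φ.obj (op X)))⁻¹ ^ ((1 : ℕ+) : ℕ) *
            Algebra.GrothendieckGroup.of (y : Φ.obj (op X)) = pullGp Φ (𝟙 X) 1 * divB Φ B DivB (op X) 1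
        rw [PNat.one_coe, pow_one, map_one, map_one, one_mul, inv_mul_cancel] }
  have h₂ : PreFrobenioid.IsPreStep (toElem Φ B DivB) δ₂ := ⟨rfl, show IsIso (𝟙 X) from inferInstance⟩
  have h₁ : PreFrobenioid.IsCoAngularPreStep (toElem Φ B DivB) δ₁ :=
    ⟨isCoAngular (isGroupLike_of_isUnit hB) δ₁, rfl, show IsIso (𝟙 X) from inferInstance⟩
  have hbe : PreFrobenioid.BaseEquivalent (toElem Φ B DivB) δ₁ δ₂ := rfl
  have hmem := PreFrobenioid.div_invDiv_mem_biratSubfunctor (toElem Φ B DivB) δ₁ δ₂ h₁ h₂ hbe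
  have e : Algebra.GrothendieckGroup.of (PreFrobenioid.invDiv (toElem Φ B DivB) δ₁ h₁.2.2) /
      Algebra.GrothendieckGroup.of (PreFrobenioid.invDiv (toElem Φ B DivB) δ₂ h₂.2) = divB Φ B DivB (op X) b := by
    rw [hbxy]
    show Algebra.GrothendieckGroup.of (Frobenioids.pull Φ (inv (𝟙 X)) x) /
        Algebra.GrothendieckGroup.of (Frobenioids.pull Φ (inv (𝟙 X)) (y : Φ.obj (op X))) = _
    simp only [IsIso.inv_id, Frobenioids.pull_id]
  rw [← e]
  exact hmem

/-! ### `Φ^birat` of the model Frobenioid is the image of `Div_B` -/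

/-- **`Φ^birat(X) = Div_B(B(X))`** for the model Frobenioid of `(Φ, B, Div_B)`, `B` group-like (Thm. 5.2:
"the group-like monoid `Φ^birat ⊆ Φ^gp` determined by the image of `Div_B`" IS the concrete rational-function
subfunctor). [cite: MochizukiFrdI2008, Thm. 5.2 (ii) p.101] -/
theorem biratSubfunctor_carrier_eq (hB : ∀ (A : Dᵒᵖ) (b : B.obj A), IsUnit b) (X : D) :
    (PreFrobenioid.biratSubfunctor (toElem Φ B DivB)).carrier X = (GpSubfunctor.ofModelData Φ B DivB hB).carrier X := by
  apply le_antisymm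
  · exact PreFrobenioid.biratSubfunctor_le _ (GpSubfunctor.ofModelData Φ B DivB hB)
      (fun A => biratGerms_subset_biratSubmonoid hB A) X
  · rintro _ ⟨b, rfl⟩
    exact divB_mem_biratSubfunctor hB X b

/-- **`Φ^birat = ` the image of `Div_B`** as subfunctors of groups of `Φ^gp`.
[cite: MochizukiFrdI2008, Thm. 5.2 (ii) p.101] -/
theorem biratSubfunctor_eq_ofModelData (hB : ∀ (A : Dᵒᵖ) (b : B.obj A), IsUnit b) :
    PreFrobenioid.biratSubfunctor (toElem Φ B DivB) = GpSubfunctor.ofModelData Φ B DivB hB :=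
  GpSubfunctor.ext_carrier (funext (biratSubfunctor_carrier_eq hB))

/-- The concrete `Φ^birat` of the model Frobenioid "is the image of `Div_B`" in the sense of abc-iut-L1-t2's
interface `IsImageOfDivB` (so `ModelFrobenioidUntr.nonempty_untr_equivalence_modelOf` applies to it).
[cite: MochizukiFrdI2008, Prop. 5.5 (iv) p.104] -/
theorem isImageOfDivB_biratSubfunctor (hB : ∀ (A : Dᵒᵖ) (b : B.obj A), IsUnit b) :
    IsImageOfDivB Φ B DivB (PreFrobenioid.biratSubfunctor (toElem Φ B DivB)) := by
  intro A c
  rw [biratSubfunctor_carrier_eq hB]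
  rfl

end ModelFrobenioid

/-! ### Prop. 5.5 (iv), `C^rlf`: the slot `Prop55iv_rlf` -/

namespace FrdI.Prop55Sub

variable {D : Type u} [Category.{v} D] (Φ B : Dᵒᵖ ⥤ CommMonCat.{w}) (DivB : B ⟶ monoidGp Φ)

/-- **Prop. 5.5 (iv) for `C^rlf` — the slot `FrdI.Prop55Sub.Prop55iv_rlf Φ B DivB hB hΦ` PROVED**: THE
realification `C^rlf` of the model Frobenioid `C` of `(Φ, B, Div_B)` (`B` group-like, `Φ` perf-factorial) is
the model Frobenioid of `(Φ^rlf, ℝ · Φ^birat)` with `Φ^birat = Div_B(B)` (`biratSubfunctor_eq_ofModelData`),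
i.e. LITERALLY the model Frobenioid of the data `Φ^rlf, ℝ · Div_B(B), ℝ · Div_B(B) ↪ (Φ^rlf)^gp`; the
equivalence is the identity and the compatibility with the functors to `F_{Φ^rlf}` is the unitor ("follows
immediately from the definitions", p. 105 l. 26).  The Frobenius-isotropic / Frobenius-normalized hypotheses of
the slot are not needed. [cite: MochizukiFrdI2008, Prop. 5.5 (iv) p.104] -/
theorem prop55iv_rlf_holds (hB : ∀ (A : Dᵒᵖ) (b : B.obj A), IsUnit b) (hΦ : PreFrobenioid.IsPerfFactorialOn Φ) :
    Prop55iv_rlf Φ B DivB hB hΦ := by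
  intro _ _
  show ∃ e : (RealificationData.canonical Φ (PreFrobenioid.IsPerfFactorialOn.op hΦ)).RlfModelOf
      (PreFrobenioid.biratSubfunctor (ModelFrobenioid.toElem Φ B DivB)) ≌
      (RealificationData.canonical Φ (PreFrobenioid.IsPerfFactorialOn.op hΦ)).RlfModelOf
        (GpSubfunctor.ofModelData Φ B DivB hB),
    Nonempty (e.functor ⋙ ModelFrobenioid.toElem _ _ _ ≅ ModelFrobenioid.toElem _ _ _)
  rw [ModelFrobenioid.biratSubfunctor_eq_ofModelData hB]
  exact ⟨CategoryTheory.Equivalence.refl, ⟨Functor.leftUnitor _⟩⟩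

end FrdI.Prop55Sub

end Literature.AlgebraicGeometry.Frobenioids
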